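import Literature.AlgebraicGeometry.AbelianSchemes.PoincareFamilyKSSurjective
import Literature.AlgebraicGeometry.AbelianSchemes.AbelianSchemeSmallExtensionPicardTorsor
import HarnessLib

/-!
# Kodaira–Spencer SURJECTIVITY of the Poincaré family at lift level in ANY characteristic — the letter S-e of the (Mc) N3′ tower
# with the `ℚ`-algebra hypothesis REMOVED (Mumford, *Abelian Varieties* §13, pp. 126–127; Hartshorne, *Deformation Theory* Thm. 6.4)

Layer `Literature/AlgebraicGeometry/AbelianSchemes`, namespace `Literature.AlgebraicGeometry.AbelianSchemes.AbelianSchemeOver`.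
THEOREMS ONLY (no definition, no named fact, no instance, no notation, no `sorry`).  Cell `hodgecm-mathlib` (D-0151), P6 «MOD programme»,
DUAL-S road (A) in characteristic `p` (pay-down of the printed row P-2′ `dualAbelianSchemeExists`; seat LA4-p05 (g0), L4 DUALS road), letter
**(Se′)** = ★ `PoincareFamilyKSSurjective.exists_lift_detClassH_eq_add_smallExtension` OFF `ℚ`.

WHERE `ℚ` ENTERED.  In ★ `PoincareFamilyKSSurjective` (S-e) and ★ `AbelianSchemeSmallExtensionIdealCohomologyDimension` (K4, the TARGET-SPACE
panel `E : H¹(A′_{C′}, 𝓘) ≃+ κ^g`) the binder `[Algebra ℚ R]` is used at exactly ONE place: the count «`dim_κ Ȟ¹(𝔘, 𝒪_{A′_κ}) = dim A′_κ`» was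
★ only in characteristic `0` ((H1′) `AbelianVarieties.finrank_cechH1_structureSheaf_eq_dim_of_charZero`, by transport from `ℂ`); in ★ S-c1
`AbelianSchemeSmallExtensionIdealCohomology.exists_structureSheafCohomology_addEquiv_idealCohomology_smallExtension` the binder is idle.  The count
[MumfordAV1970] §13 Cor. 2 in characteristic `p` is NOT hypothesis-free in the tree (road (A) pays it only from Poincaré data ∕ an invertible
`K(L)`-exponent — heads (H-a)∕(H-b), B-p04 (g42); LA4-plan (g0) ruling 2026-09-02T03:21:41Z (5)), so this file carries it as the HYPOTHESIS
`hH1` («for every field point `s` of `S′` and every finite affine open cover `𝔘` of `A′_s`: `Ȟ¹(𝔘, 𝒪)` is finite of rank `dim A′_s`»), threaded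
to the consumers (N3′ tower → Mc′ → M′ → the DUALS letter, which discharges it from (H-b) with its own `n, hkill`), and re-runs the three ★ proofs
VERBATIM otherwise:
* §1 `exists_structureSheafCohomology_addEquiv_idealCohomology_smallExtension_anyBase` — S-c1 (`H¹(A′_κ, 𝒪) ≃ H¹(𝓘)` with scalars and the
  cocycle clause) over any Noetherian affine base (★ `exists_structureSheafCohomology_addEquiv_idealCohomology_of_flat`, unchanged);
* §2 **`exists_addEquiv_idealCohomology_pi_smallExtension_anyBase`** (+ `_of_isOfRelDim_anyBase`,
  `_residueField_…_anyBase`) — K4 `E : H¹(X′, 𝓘) ≃+ (Fin g → K)` with the scalar clause, any characteristic;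
* §3 **`exists_lift_detClassH_eq_add_smallExtension_anyBase`** — S-e: for a lift `g₁ : Spec C′ → Â′` and any `t ∈ H¹(X′, 𝓘)` a second lift
  `g₂` of the same `C`-point with `[(1 × g₂)^*𝒫′] = [(1 × g₁)^*𝒫′] + H¹(truncExp)(t)` (★ `exists_lift_detClassH_eq_add_of_principal`, which never
  used `ℚ`, fed by §2).
Consumed by the any-characteristic (Mc) N3′ Artinian tower (road (A) re-thread: N3′ → Mc′ → M′ → F3′ head «a projective abelian scheme with an
invertible `K(L)`-exponent has a dual pair»).  ED. 2 (heartbeat cure, proof-only): in §2 and §3 every `obtain` on an APPLIED term now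
instantiates the term by a `have` first and destructures the local afterwards (`exists_addEquiv_idealCohomology_pi_smallExtension_anyBase`
184k → 88k, `exists_lift_detClassH_eq_add_smallExtension_anyBase` 125k → 30k heartbeats, both at the default budget, measured with
`#count_heartbeats` under `Elab.async false`); no statement, import or other proof byte changed.  HC_CM is proved only modulo the printed citations (2 remaining named inputs hLiu418 24832,
h413 24833) until rung 0 closes; nothing here is about HC (count-neutral ★ capital).

## References
* [MumfordAV1970] D. Mumford, *Abelian Varieties* (1970), §13, proof of the Theorem pp. 125–130 («both have dimension `g`») and Cor. 2 (p. 129).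
* [Hartshorne2010] R. Hartshorne, *Deformation Theory*, GTM 257 (2010), §6 (6.1) pp. 46–47 and Thm. 6.4 (b) with its proof (pp. 50–51).
* [Hartshorne1977] R. Hartshorne, *Algebraic Geometry* (1977), III Thm. 4.5 (p. 222), III Lemma 2.10 (p. 209).
* Tree: ★ `PoincareFamilyKSSurjective` (`exists_lift_detClassH_eq_add_of_principal`, `sheafH_idealSheafAb_eq_zero_of_isIso`), ★
  `AbelianSchemeSmallExtensionIdealCohomologyDimension` (`exists_idealSheafAb_hom_mul_specStructureMap`), ★ `AbelianSchemeSmallExtensionIdealCohomology`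
  (`exists_structureSheafCohomology_addEquiv_idealCohomology_of_flat`), ★ `AbelianSchemeSmallExtensionPicardTorsor` (`isPullback_whiskerLeft_left_snd`),
-/

set_option autoImplicit false

noncomputable section

-- `(X ⊗ T).left = pullback X.hom T.hom` (`Over.tensorObj_left`) and `(A.fibre s).left = pullback A.X.hom s` are `rfl` only at default
-- transparency (as in ★ `AbelianSchemeSmallExtensionIdealCohomologyDimension`, ★ `PoincareFamilyKSSurjective`).
set_option backward.isDefEq.respectTransparency false

universe u

open CategoryTheory CategoryTheory.Limits AlgebraicGeometry MonoidalCategory CartesianMonoidalCategory Opposite TopologicalSpace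
open scoped MonObj

namespace Literature.AlgebraicGeometry.AbelianSchemes

open Literature.AlgebraicGeometry.Motives Literature.AlgebraicGeometry.Modules Literature.AlgebraicGeometry.Deformation
  Literature.AlgebraicGeometry.Morphisms Literature.AlgebraicGeometry.AbelianVarieties IsLocalRing

namespace AbelianSchemeOver

/-! ## §1 S-c1 over any Noetherian affine base: `H¹(A′_κ, 𝒪) ≃ H¹(A′_{C′}, 𝓘)` intertwining scalars -/

/-- `Spec K → Spec C′` is surjective for a residue field of an Artinian local ring (one-point spectrum). [folklore] -/
private theorem surjective_specMap_of_isArtinianRing' {C' K : Type} [CommRing C'] [IsLocalRing C'] [IsArtinianRing C'] [Field K]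
    (π₀ : C' →+* K) : Surjective (Spec.map (CommRingCat.ofHom π₀)) := by
  refine ⟨fun x => ⟨IsLocalRing.closedPoint K, ?_⟩⟩
  apply PrimeSpectrum.ext
  have h1 : (Spec.map (CommRingCat.ofHom π₀) (IsLocalRing.closedPoint K)).asIdeal = maximalIdeal C' := by
    haveI : (Spec.map (CommRingCat.ofHom π₀) (IsLocalRing.closedPoint K)).asIdeal.IsMaximal :=
      IsArtinianRing.isMaximal_of_isPrime _
    exact IsLocalRing.eq_maximalIdeal inferInstance
  have h2 : x.asIdeal = maximalIdeal C' := by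
    haveI : x.asIdeal.IsMaximal := IsArtinianRing.isMaximal_of_isPrime _
    exact IsLocalRing.eq_maximalIdeal inferInstance
  rw [h1, h2]

/-- **S-c1 IN ANY CHARACTERISTIC — `H¹(A′_κ, 𝒪_{A′_κ}) ≃ H¹(A′_{C′}, 𝓘)` INTERTWINING SCALARS** for the principal small extension `A′_C ⊂ A′_{C′}`
of the abelian scheme `A′ = A.baseChange p` over a Noetherian affine base `Spec R` (NO `ℚ`-structure): ★
`Deformation`-side `exists_structureSheafCohomology_addEquiv_idealCohomology_of_flat` (`Hⁿ(X₀, 𝒪) = Hⁿ(X′, j_*𝒪_{X₀})`, `j_*𝒪_{X₀} ≅ 𝓘`) run on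
the flat `A′_{C′} → Spec C′`, with the SCALAR clause and the COCYCLE clause — the ★ S-c1 statement with its idle binder `[Algebra ℚ R]` removed,
proof verbatim. [cite: Hartshorne2010, §6 (6.1) pp. 46–47 and Thm. 6.4 (b) with its proof (pp. 50–51)]
[cite: Hartshorne1977, III Lemma 2.10 (p. 209)] -/
theorem exists_structureSheafCohomology_addEquiv_idealCohomology_smallExtension_anyBase :
    ∀ (R : Type) [CommRing R] [IsNoetherianRing R] (A : AbelianSchemeOver (Spec (.of R)))
    {S' : Scheme.{0}} [IsAffine S'] (p : S' ⟶ Spec (.of R)) [IsFinite p] [Etale p] [Surjective p]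
    (C' C K : Type) [CommRing C'] [IsLocalRing C'] [IsArtinianRing C'] [CommRing C] [Field K]
    (q : C' →+* C) (_hq : Function.Surjective q) (t₀ : C') (_hker : RingHom.ker q = Ideal.span {t₀})
    (_htm : ∀ m ∈ IsLocalRing.maximalIdeal C', t₀ * m = 0) (_ht₀ : t₀ ≠ 0)
    (π₀ : C' →+* K) (_hπ₀ : Function.Surjective π₀) (_hkπ : RingHom.ker π₀ = IsLocalRing.maximalIdeal C')
    (c' : Spec (.of C') ⟶ S')
    (ι₀ : Over.mk (Spec.map (CommRingCat.ofHom q) ≫ c') ⟶ Over.mk c') (_hι : ι₀.left = Spec.map (CommRingCat.ofHom q))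
    (ικ : Over.mk (Spec.map (CommRingCat.ofHom π₀) ≫ c') ⟶ Over.mk c') (_hικ : ικ.left = Spec.map (CommRingCat.ofHom π₀)),
    ∃ e : Motives.structureSheafCohomology ((A.baseChange p).X ⊗ Over.mk (Spec.map (CommRingCat.ofHom π₀) ≫ c')).left 1 ≃+
        (idealSheafAb ((A.baseChange p).X ◁ ι₀).left).H 1,
      (∀ (c : C') (mu : idealSheafAb ((A.baseChange p).X ◁ ι₀).left ⟶ idealSheafAb ((A.baseChange p).X ◁ ι₀).left)
        (nu : structureSheafAb ((A.baseChange p).X ⊗ Over.mk (Spec.map (CommRingCat.ofHom π₀) ≫ c')).left ⟶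
          structureSheafAb ((A.baseChange p).X ⊗ Over.mk (Spec.map (CommRingCat.ofHom π₀) ≫ c')).left),
        (∀ (V : ((A.baseChange p).X ⊗ Over.mk c').left.Opens) (x : (idealSheafAb ((A.baseChange p).X ◁ ι₀).left).obj.obj (op V)),
          idealVal ((A.baseChange p).X ◁ ι₀).left V (mu.hom.app (op V) x) =
            ((A.baseChange p).X ⊗ Over.mk c').left.presheaf.map (homOfLE le_top).op
              (specStructureMap (Limits.pullback.snd (A.baseChange p).X.hom c') c) *
              idealVal ((A.baseChange p).X ◁ ι₀).left V x) →
        (∀ (W : ((A.baseChange p).X ⊗ Over.mk (Spec.map (CommRingCat.ofHom π₀) ≫ c')).left.Opens)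
          (y : Γ(((A.baseChange p).X ⊗ Over.mk (Spec.map (CommRingCat.ofHom π₀) ≫ c')).left, W)),
          ((nu.hom.app (op W)) y : Γ(((A.baseChange p).X ⊗ Over.mk (Spec.map (CommRingCat.ofHom π₀) ≫ c')).left, W)) =
            (((A.baseChange p).X ⊗ Over.mk (Spec.map (CommRingCat.ofHom π₀) ≫ c')).left.presheaf.map (homOfLE (le_top : W ≤ ⊤)).op
              (specStructureMap (Limits.pullback.snd (A.baseChange p).X.hom (Spec.map (CommRingCat.ofHom π₀) ≫ c')) (π₀ c)) :
              Γ(((A.baseChange p).X ⊗ Over.mk (Spec.map (CommRingCat.ofHom π₀) ≫ c')).left, W)) * y) →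
        ∀ a, e (Sheaf.H.map nu 1 a) = Sheaf.H.map mu 1 (e a)) ∧
      (∀ {J : Type} (𝒲 : J → ((A.baseChange p).X ⊗ Over.mk c').left.Opens) (h𝒲 : iSup 𝒲 = ⊤)
        (h𝒲₀ : iSup (fun a => ((A.baseChange p).X ◁ ικ).left ⁻¹ᵁ 𝒲 a) = ⊤)
        (x : cechOneCocycles (idealSheafAb ((A.baseChange p).X ◁ ι₀).left) 𝒲)
        (y : cechOneCocycles (structureSheafAb ((A.baseChange p).X ⊗ Over.mk (Spec.map (CommRingCat.ofHom π₀) ≫ c')).left)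
          (fun a => ((A.baseChange p).X ◁ ικ).left ⁻¹ᵁ 𝒲 a)),
        (∀ a b, ∃ bab : Γ(((A.baseChange p).X ⊗ Over.mk c').left, 𝒲 a ⊓ 𝒲 b),
          ((A.baseChange p).X ◁ ικ).left.app (𝒲 a ⊓ 𝒲 b) bab =
            (y : CechOneCochain (structureSheafAb ((A.baseChange p).X ⊗ Over.mk (Spec.map (CommRingCat.ofHom π₀) ≫ c')).left)
              (fun a => ((A.baseChange p).X ◁ ικ).left ⁻¹ᵁ 𝒲 a)) a b ∧
          idealVal ((A.baseChange p).X ◁ ι₀).left (𝒲 a ⊓ 𝒲 b)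
              ((x : CechOneCochain (idealSheafAb ((A.baseChange p).X ◁ ι₀).left) 𝒲) a b) =
            ((A.baseChange p).X ⊗ Over.mk c').left.presheaf.map (homOfLE (le_top : 𝒲 a ⊓ 𝒲 b ≤ ⊤)).op
              (specStructureMap (Limits.pullback.snd (A.baseChange p).X.hom c') t₀) * bab) →
        e (cechToH (structureSheafAb ((A.baseChange p).X ⊗ Over.mk (Spec.map (CommRingCat.ofHom π₀) ≫ c')).left)
            (fun a => ((A.baseChange p).X ◁ ικ).left ⁻¹ᵁ 𝒲 a) h𝒲₀ y) =
          cechToH (idealSheafAb ((A.baseChange p).X ◁ ι₀).left) 𝒲 h𝒲 x) := by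
  intro R _ _ A S' _ p _ _ _ C' C K _ _ _ _ _ q hq t₀ hker htm ht₀ π₀ hπ₀ hkπ c' ι₀ hι ικ hικ
  haveI : Smooth (A.baseChange p).X.hom := (A.baseChange p).isSmooth
  haveI : Flat (A.baseChange p).X.hom := inferInstance
  have hflat : Flat (Limits.pullback.snd (A.baseChange p).X.hom c') := MorphismProperty.pullback_snd (P := @Flat) _ _ inferInstance
  have Hi : IsPullback ((A.baseChange p).X ◁ ι₀).left
      (Limits.pullback.snd (A.baseChange p).X.hom (Spec.map (CommRingCat.ofHom q) ≫ c'))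
      (Limits.pullback.snd (A.baseChange p).X.hom c') (Spec.map (CommRingCat.ofHom q)) := by
    have h := isPullback_whiskerLeft_left_snd (A.baseChange p).X ι₀
    rw [hι] at h
    exact h
  have Hj : IsPullback ((A.baseChange p).X ◁ ικ).left
      (Limits.pullback.snd (A.baseChange p).X.hom (Spec.map (CommRingCat.ofHom π₀) ≫ c'))
      (Limits.pullback.snd (A.baseChange p).X.hom c') (Spec.map (CommRingCat.ofHom π₀)) := by
    have h := isPullback_whiskerLeft_left_snd (A.baseChange p).X ικ
    rw [hικ] at h
    exact h
  haveI : IsClosedImmersion (Spec.map (CommRingCat.ofHom π₀)) := IsClosedImmersion.spec_of_surjective _ hπ₀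
  haveI : Surjective (Spec.map (CommRingCat.ofHom π₀)) := surjective_specMap_of_isArtinianRing' π₀
  have hjc : IsClosedImmersion ((A.baseChange p).X ◁ ικ).left :=
    MorphismProperty.of_isPullback (P := @IsClosedImmersion) Hj.flip inferInstance
  have hjs : Surjective ((A.baseChange p).X ◁ ικ).left :=
    MorphismProperty.of_isPullback (P := @Surjective) Hj.flip inferInstance
  exact exists_structureSheafCohomology_addEquiv_idealCohomology_of_flat (Limits.pullback.snd (A.baseChange p).X.hom c') hflat q hq
    t₀ hker π₀ hπ₀ hkπ htm ht₀ hjc hjs Hi Hj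

/-! ## §2 K4 in any characteristic: the target-space panel `E : H¹(X′, 𝓘) ≃+ (Fin g → K)` with scalars -/

/-- A quasi-compact scheme has a FINITE affine open cover indexed by a type in `Type`. [folklore] -/
private theorem exists_finite_isAffineOpen_cover' (X : Scheme.{0}) [CompactSpace X] :
    ∃ (J : Type) (_ : Finite J) (U : J → X.Opens), (∀ i, IsAffineOpen (U i)) ∧ iSup U = ⊤ := by
  obtain ⟨s, hs, e⟩ := (isCompact_iff_finite_and_eq_biUnion_affineOpens (U := (⊤ : X.Opens))).mp
    (by simpa using isCompact_univ)
  haveI := hs.to_subtype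
  refine ⟨s, inferInstance, fun i => i.1.1, fun i => i.1.2, ?_⟩
  rw [iSup_subtype]
  exact e.symm

/-- The underlying space of `A′ ×_{S′} Spec K` (in the `Over S′`-spelling) is quasi-compact. [folklore] -/
private theorem compactSpace_tensor_fibre' {S' : Scheme.{0}} (A' : AbelianSchemeOver S') {K : Type} [Field K] (s : Spec (.of K) ⟶ S') :
    CompactSpace ↥(A'.X ⊗ Over.mk s).left := by
  haveI : IsProper (Limits.pullback.snd A'.X.hom s) := MorphismProperty.pullback_snd (P := @IsProper) _ _ A'.isProper
  exact QuasiCompact.compactSpace_of_compactSpace (X := (A'.X ⊗ Over.mk s).left) (Limits.pullback.snd A'.X.hom s)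

/-- **K4 IN ANY CHARACTERISTIC — TARGET SPACE OF THE KODAIRA–SPENCER COUNT** ([MumfordAV1970] §13 pp. 126–127: «… `H¹(𝒪) ⊗ (t₀)` … both have
dimension `g`»; [Hartshorne2010] Thm. 6.4 (b)).  For the principal small extension `A′_C ⊂ A′_{C′}` of the abelian scheme `A′ = A.baseChange p` over a
Noetherian affine base `Spec R` of ANY characteristic (ideal `𝓘` of the thickening `(A′.X ◁ ι₀).left`), a residue field `π₀ : C′ ↠ K` and
`g := dim A′_K`, there is an additive isomorphism `E : H¹(A′_{C′}, 𝓘) ≃+ (Fin g → K)` such that every endomorphism `μ` of `𝓘` acting sectionwise as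
multiplication by the global function `c ∈ C′` acts through `E` as the scalar `π₀ c`.  (`E = ℓ ∘ e₂ ∘ e₁⁻¹`: §1 S-c1′, S-c2 ★
`Motives.exists_addEquiv_structureSheafCohomology_cechH1`, the count HYPOTHESIS `hH1` at the closed fibre, a `K`-basis `ℓ`.)
★ `exists_addEquiv_idealCohomology_pi_smallExtension` without `[Algebra ℚ R]`, proof verbatim.
[cite: MumfordAV1970, §13 (proof of the Theorem, pp. 126–127) and Cor. 2 (p. 129)] [cite: Hartshorne2010, §6 (6.1) pp. 46–47 and Thm. 6.4 (b) (pp. 50–51)]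
[cite: Hartshorne1977, III Thm. 4.5 (p. 222)] -/
theorem exists_addEquiv_idealCohomology_pi_smallExtension_anyBase :
    ∀ (R : Type) [CommRing R] [IsNoetherianRing R] (A : AbelianSchemeOver (Spec (.of R)))
    {S' : Scheme.{0}} [IsAffine S'] (p : S' ⟶ Spec (.of R)) [IsFinite p] [Etale p] [Surjective p]
    (hH1 : ∀ (K₁ : Type) [Field K₁] (s : Spec (.of K₁) ⟶ S') {J : Type} [Finite J]
      (U : J → ((A.baseChange p).X ⊗ Over.mk s).left.Opens), (∀ i, IsAffineOpen (U i)) → iSup U = ⊤ →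
      Module.Finite K₁ (CechH1 (X := ((A.baseChange p).X ⊗ Over.mk s).left) (Limits.pullback.snd (A.baseChange p).X.hom s) U) ∧
        Module.finrank K₁ (CechH1 (X := ((A.baseChange p).X ⊗ Over.mk s).left) (Limits.pullback.snd (A.baseChange p).X.hom s) U) =
          ((A.baseChange p).fibre s).toAbelianVariety.dim)
    (C' C K : Type) [CommRing C'] [IsLocalRing C'] [IsArtinianRing C'] [CommRing C] [Field K]
    (q : C' →+* C) (_hq : Function.Surjective q) (t₀ : C') (_hker : RingHom.ker q = Ideal.span {t₀})
    (_htm : ∀ m ∈ IsLocalRing.maximalIdeal C', t₀ * m = 0) (_ht₀ : t₀ ≠ 0)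
    (π₀ : C' →+* K) (_hπ₀ : Function.Surjective π₀) (_hkπ : RingHom.ker π₀ = IsLocalRing.maximalIdeal C')
    (c' : Spec (.of C') ⟶ S')
    (ι₀ : Over.mk (Spec.map (CommRingCat.ofHom q) ≫ c') ⟶ Over.mk c') (_hι : ι₀.left = Spec.map (CommRingCat.ofHom q))
    (g : ℕ) (_hg : ((A.baseChange p).fibre (Spec.map (CommRingCat.ofHom π₀) ≫ c')).toAbelianVariety.dim = g),
    ∃ E : (idealSheafAb ((A.baseChange p).X ◁ ι₀).left).H 1 ≃+ (Fin g → K),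
      ∀ (c : C') (mu : idealSheafAb ((A.baseChange p).X ◁ ι₀).left ⟶ idealSheafAb ((A.baseChange p).X ◁ ι₀).left),
        (∀ (V : ((A.baseChange p).X ⊗ Over.mk c').left.Opens) (x : (idealSheafAb ((A.baseChange p).X ◁ ι₀).left).obj.obj (op V)),
          idealVal ((A.baseChange p).X ◁ ι₀).left V (mu.hom.app (op V) x) =
            ((A.baseChange p).X ⊗ Over.mk c').left.presheaf.map (homOfLE le_top).op
              (specStructureMap (Limits.pullback.snd (A.baseChange p).X.hom c') c) *
              idealVal ((A.baseChange p).X ◁ ι₀).left V x) →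
        ∀ t : (idealSheafAb ((A.baseChange p).X ◁ ι₀).left).H 1, E (Sheaf.H.map mu 1 t) = π₀ c • E t := by
  intro R _ _ A S' _ p _ _ _ hH1 C' C K _ _ _ _ _ q hq t₀ hker htm ht₀ π₀ hπ₀ hkπ c' ι₀ hι g hg
  -- the closed fibre `X₀ = A′_K ↪ X′` over `S′`
  have hικ₀ : ∃ ικ : Over.mk (Spec.map (CommRingCat.ofHom π₀) ≫ c') ⟶ Over.mk c',
      ικ.left = Spec.map (CommRingCat.ofHom π₀) := ⟨Over.homMk (Spec.map (CommRingCat.ofHom π₀)) rfl, rfl⟩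
  obtain ⟨ικ, hικ⟩ := hικ₀
  -- (S-c1′) `e₁ : H¹(X₀, 𝒪) ≃+ H¹(X′, 𝓘)` with scalars
  have hSc1 := exists_structureSheafCohomology_addEquiv_idealCohomology_smallExtension_anyBase R A p C' C K q hq t₀ hker
    htm ht₀ π₀ hπ₀ hkπ c' ι₀ hι ικ hικ
  obtain ⟨e₁, hsc₁, -⟩ := hSc1
  -- a finite affine open cover `𝔘` of `X₀`
  haveI := compactSpace_tensor_fibre' (A.baseChange p) (Spec.map (CommRingCat.ofHom π₀) ≫ c')
  have hcov := exists_finite_isAffineOpen_cover' ((A.baseChange p).X ⊗ Over.mk (Spec.map (CommRingCat.ofHom π₀) ≫ c')).left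
  obtain ⟨J, _, U, hUaff, hUcov⟩ := hcov
  -- (S-c2) `e₂ : H¹(X₀, 𝒪) ≃+ Ȟ¹(𝔘, 𝒪_{X₀})` with scalars (structure map `f₀ = pr₂ : X₀ → Spec K`)
  have hSc2 := Motives.exists_addEquiv_structureSheafCohomology_cechH1
    (X := ((A.baseChange p).X ⊗ Over.mk (Spec.map (CommRingCat.ofHom π₀) ≫ c')).left)
    (Limits.pullback.snd (A.baseChange p).X.hom (Spec.map (CommRingCat.ofHom π₀) ≫ c')) U hUaff hUcov
  obtain ⟨e₂, -, hsc₂⟩ := hSc2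
  -- ([MumfordAV1970] §13 Cor. 2, any characteristic) `dim_K Ȟ¹(𝔘, 𝒪_{X₀}) = dim A′_K = g` — the count hypothesis instantiated FIRST as a
  -- `have`, then destructured (an `obtain` straight on the applied term costs ≈ 99k heartbeats here, the split ≈ 0.5k: ED. 2 heartbeat cure)
  have hH1K := hH1 K (Spec.map (CommRingCat.ofHom π₀) ≫ c') U hUaff hUcov
  obtain ⟨hfin, hrk⟩ := hH1K
  haveI := hfin
  -- a `K`-basis of `Ȟ¹`: `ℓ : Ȟ¹(𝔘, 𝒪_{X₀}) ≃ₗ[K] (Fin g → K)`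
  let ℓ : CechH1 (X := ((A.baseChange p).X ⊗ Over.mk (Spec.map (CommRingCat.ofHom π₀) ≫ c')).left)
      (Limits.pullback.snd (A.baseChange p).X.hom (Spec.map (CommRingCat.ofHom π₀) ≫ c')) U ≃ₗ[K] (Fin g → K) :=
    (Module.finBasisOfFinrankEq K _ (hrk.trans hg)).equivFun
  refine ⟨(e₁.symm.trans e₂).trans ℓ.toAddEquiv, fun c mu hmu t => ?_⟩
  -- the endomorphism `ν` of `𝒪_{X₀}` matching `μ` (S-c2 §4: multiplication by the global function `f₀♯(π₀ c)`)
  have hν₀ := Motives.exists_structureSheafAb_hom_mul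
    (X := ((A.baseChange p).X ⊗ Over.mk (Spec.map (CommRingCat.ofHom π₀) ≫ c')).left)
    (specStructureMap (Limits.pullback.snd (A.baseChange p).X.hom (Spec.map (CommRingCat.ofHom π₀) ≫ c')) (π₀ c))
  obtain ⟨nu, hnu⟩ := hν₀
  have hν' : ∀ (W : ((A.baseChange p).X ⊗ Over.mk (Spec.map (CommRingCat.ofHom π₀) ≫ c')).left.Opens)
      (y : Γ(((A.baseChange p).X ⊗ Over.mk (Spec.map (CommRingCat.ofHom π₀) ≫ c')).left, W)),
      ((nu.hom.app (op W)) y : Γ(((A.baseChange p).X ⊗ Over.mk (Spec.map (CommRingCat.ofHom π₀) ≫ c')).left, W)) =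
        (((A.baseChange p).X ⊗ Over.mk (Spec.map (CommRingCat.ofHom π₀) ≫ c')).left.presheaf.map (homOfLE (le_top : W ≤ ⊤)).op
          (specStructureMap (Limits.pullback.snd (A.baseChange p).X.hom (Spec.map (CommRingCat.ofHom π₀) ≫ c')) (π₀ c)) :
          Γ(((A.baseChange p).X ⊗ Over.mk (Spec.map (CommRingCat.ofHom π₀) ≫ c')).left, W)) * y := hnu
  have key := hsc₁ c mu nu hmu hν' (e₁.symm t)
  have h₁ : e₁.symm (Sheaf.H.map mu 1 t) = Sheaf.H.map nu 1 (e₁.symm t) :=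
    e₁.injective (((e₁.apply_symm_apply _).trans
      (congrArg (Sheaf.H.map mu 1) (e₁.apply_symm_apply t)).symm).trans key.symm)
  have h₂ : e₂ (Sheaf.H.map nu 1 (e₁.symm t)) = π₀ c • e₂ (e₁.symm t) :=
    hsc₂ (π₀ c) nu (fun V x => by rw [Sections.algebraMap_apply]; exact hnu V x) _
  calc ((e₁.symm.trans e₂).trans ℓ.toAddEquiv) (Sheaf.H.map mu 1 t) = ℓ (e₂ (e₁.symm (Sheaf.H.map mu 1 t))) := rfl
    _ = ℓ (e₂ (Sheaf.H.map nu 1 (e₁.symm t))) := congrArg (fun z => ℓ (e₂ z)) h₁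
    _ = ℓ (π₀ c • e₂ (e₁.symm t)) := congrArg ℓ h₂
    _ = π₀ c • ℓ (e₂ (e₁.symm t)) := ℓ.map_smul _ _
    _ = π₀ c • ((e₁.symm.trans e₂).trans ℓ.toAddEquiv) t := rfl

/-- **K4 in any characteristic, with the dimension hypothesis as the RELATIVE DIMENSION of the closed fibre** (`hg : (A′.baseChange s_K).IsOfRelDim g`)
— ★ `exists_addEquiv_idealCohomology_pi_smallExtension_of_isOfRelDim` without `[Algebra ℚ R]` (`dim A′_K = g` by uniqueness of the relative
dimension of a smooth morphism with non-empty source, ★ `AbelianScheme.isOfRelDim_dim`, ★ `Motives.AbelianVarietyProofs.eq_of_smoothOfRelativeDimension`).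
[cite: MumfordAV1970, §13 (proof of the Theorem, pp. 126–127) and Cor. 2 (p. 129)] [cite: GortzWedhorn2020, Remark 16.54] -/
theorem exists_addEquiv_idealCohomology_pi_smallExtension_of_isOfRelDim_anyBase :
    ∀ (R : Type) [CommRing R] [IsNoetherianRing R] (A : AbelianSchemeOver (Spec (.of R)))
    {S' : Scheme.{0}} [IsAffine S'] (p : S' ⟶ Spec (.of R)) [IsFinite p] [Etale p] [Surjective p]
    (hH1 : ∀ (K₁ : Type) [Field K₁] (s : Spec (.of K₁) ⟶ S') {J : Type} [Finite J]
      (U : J → ((A.baseChange p).X ⊗ Over.mk s).left.Opens), (∀ i, IsAffineOpen (U i)) → iSup U = ⊤ →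
      Module.Finite K₁ (CechH1 (X := ((A.baseChange p).X ⊗ Over.mk s).left) (Limits.pullback.snd (A.baseChange p).X.hom s) U) ∧
        Module.finrank K₁ (CechH1 (X := ((A.baseChange p).X ⊗ Over.mk s).left) (Limits.pullback.snd (A.baseChange p).X.hom s) U) =
          ((A.baseChange p).fibre s).toAbelianVariety.dim)
    (C' C K : Type) [CommRing C'] [IsLocalRing C'] [IsArtinianRing C'] [CommRing C] [Field K]
    (q : C' →+* C) (_hq : Function.Surjective q) (t₀ : C') (_hker : RingHom.ker q = Ideal.span {t₀})
    (_htm : ∀ m ∈ IsLocalRing.maximalIdeal C', t₀ * m = 0) (_ht₀ : t₀ ≠ 0)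
    (π₀ : C' →+* K) (_hπ₀ : Function.Surjective π₀) (_hkπ : RingHom.ker π₀ = IsLocalRing.maximalIdeal C')
    (c' : Spec (.of C') ⟶ S')
    (ι₀ : Over.mk (Spec.map (CommRingCat.ofHom q) ≫ c') ⟶ Over.mk c') (_hι : ι₀.left = Spec.map (CommRingCat.ofHom q))
    (g : ℕ) (_hg : ((A.baseChange p).baseChange (Spec.map (CommRingCat.ofHom π₀) ≫ c')).IsOfRelDim g),
    ∃ E : (idealSheafAb ((A.baseChange p).X ◁ ι₀).left).H 1 ≃+ (Fin g → K),
      ∀ (c : C') (mu : idealSheafAb ((A.baseChange p).X ◁ ι₀).left ⟶ idealSheafAb ((A.baseChange p).X ◁ ι₀).left),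
        (∀ (V : ((A.baseChange p).X ⊗ Over.mk c').left.Opens) (x : (idealSheafAb ((A.baseChange p).X ◁ ι₀).left).obj.obj (op V)),
          idealVal ((A.baseChange p).X ◁ ι₀).left V (mu.hom.app (op V) x) =
            ((A.baseChange p).X ⊗ Over.mk c').left.presheaf.map (homOfLE le_top).op
              (specStructureMap (Limits.pullback.snd (A.baseChange p).X.hom c') c) *
              idealVal ((A.baseChange p).X ◁ ι₀).left V x) →
        ∀ t : (idealSheafAb ((A.baseChange p).X ◁ ι₀).left).H 1, E (Sheaf.H.map mu 1 t) = π₀ c • E t := by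
  intro R _ _ A S' _ p _ _ _ hH1 C' C K _ _ _ _ _ q hq t₀ hker htm ht₀ π₀ hπ₀ hkπ c' ι₀ hι g hg
  have h₁ : SmoothOfRelativeDimension g ((A.baseChange p).fibre (Spec.map (CommRingCat.ofHom π₀) ≫ c')).X.hom := hg
  have h₂ : SmoothOfRelativeDimension ((A.baseChange p).fibre (Spec.map (CommRingCat.ofHom π₀) ≫ c')).toAbelianVariety.dim
      ((A.baseChange p).fibre (Spec.map (CommRingCat.ofHom π₀) ≫ c')).X.hom :=
    ((A.baseChange p).fibre (Spec.map (CommRingCat.ofHom π₀) ≫ c')).isOfRelDim_dim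
  haveI : Nonempty ((A.baseChange p).fibre (Spec.map (CommRingCat.ofHom π₀) ≫ c')).X.left :=
    ⟨Motives.AbelianVariety.origin ((A.baseChange p).fibre (Spec.map (CommRingCat.ofHom π₀) ≫ c')).toAbelianVariety⟩
  have hdim : ((A.baseChange p).fibre (Spec.map (CommRingCat.ofHom π₀) ≫ c')).toAbelianVariety.dim = g :=
    Motives.AbelianVarietyProofs.eq_of_smoothOfRelativeDimension _ h₂ h₁
  exact exists_addEquiv_idealCohomology_pi_smallExtension_anyBase R A p hH1 C' C K q hq t₀ hker htm ht₀ π₀ hπ₀ hkπ c' ι₀ hι g hdim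

/-- **K4 in any characteristic at the residue field `κ = C′/𝔪`** (`π₀ := IsLocalRing.residue C′`), in the S-e closer's socket form —
★ `exists_addEquiv_idealCohomology_pi_residueField_smallExtension` without `[Algebra ℚ R]`.
[cite: MumfordAV1970, §13 (proof of the Theorem, pp. 126–127) and Cor. 2 (p. 129)] [cite: Hartshorne2010, §6 (6.1) pp. 46–47 and Thm. 6.4 (b) (pp. 50–51)] -/
theorem exists_addEquiv_idealCohomology_pi_residueField_smallExtension_anyBase :
    ∀ (R : Type) [CommRing R] [IsNoetherianRing R] (A : AbelianSchemeOver (Spec (.of R)))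
    {S' : Scheme.{0}} [IsAffine S'] (p : S' ⟶ Spec (.of R)) [IsFinite p] [Etale p] [Surjective p]
    (hH1 : ∀ (K₁ : Type) [Field K₁] (s : Spec (.of K₁) ⟶ S') {J : Type} [Finite J]
      (U : J → ((A.baseChange p).X ⊗ Over.mk s).left.Opens), (∀ i, IsAffineOpen (U i)) → iSup U = ⊤ →
      Module.Finite K₁ (CechH1 (X := ((A.baseChange p).X ⊗ Over.mk s).left) (Limits.pullback.snd (A.baseChange p).X.hom s) U) ∧
        Module.finrank K₁ (CechH1 (X := ((A.baseChange p).X ⊗ Over.mk s).left) (Limits.pullback.snd (A.baseChange p).X.hom s) U) =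
          ((A.baseChange p).fibre s).toAbelianVariety.dim)
    (C' C : Type) [CommRing C'] [IsLocalRing C'] [IsArtinianRing C'] [CommRing C] [IsLocalRing C] [IsArtinianRing C]
    (q : C' →+* C) (_hq : Function.Surjective q) (t₀ : C') (_hker₀ : RingHom.ker q = Ideal.span {t₀})
    (_htm : ∀ m ∈ IsLocalRing.maximalIdeal C', t₀ * m = 0) (_ht₀ : t₀ ≠ 0)
    (c' : Spec (.of C') ⟶ S')
    (ι₀ : Over.mk (Spec.map (CommRingCat.ofHom q) ≫ c') ⟶ Over.mk c') (_hι : ι₀.left = Spec.map (CommRingCat.ofHom q))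
    [IsFirstOrderThickening ((A.baseChange p).X ◁ ι₀).left]
    (g : ℕ) (_hg : ((A.baseChange p).baseChange (Spec.map (CommRingCat.ofHom (IsLocalRing.residue C')) ≫ c')).IsOfRelDim g),
    ∃ E : (idealSheafAb ((A.baseChange p).X ◁ ι₀).left).H 1 ≃+ (Fin g → IsLocalRing.ResidueField C'),
      ∀ (c : C') (mu : idealSheafAb ((A.baseChange p).X ◁ ι₀).left ⟶ idealSheafAb ((A.baseChange p).X ◁ ι₀).left),
        (∀ (U : ((A.baseChange p).X ⊗ Over.mk c').left.Opens) (y : (idealSheafAb ((A.baseChange p).X ◁ ι₀).left).obj.obj (op U)),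
          idealVal ((A.baseChange p).X ◁ ι₀).left U (mu.hom.app (op U) y) =
            ((A.baseChange p).X ⊗ Over.mk c').left.presheaf.map (homOfLE le_top).op
              (specStructureMap (pullback.snd (A.baseChange p).X.hom c') c) * idealVal ((A.baseChange p).X ◁ ι₀).left U y) →
        ∀ t, E (Sheaf.H.map mu 1 t) = IsLocalRing.residue C' c • E t := by
  intro R _ _ A S' _ p _ _ _ hH1 C' C _ _ _ _ _ _ q hq t₀ hker htm ht₀ c' ι₀ hι _ g hg
  exact exists_addEquiv_idealCohomology_pi_smallExtension_of_isOfRelDim_anyBase R A p hH1 C' C (IsLocalRing.ResidueField C') q hq t₀ hker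
    htm ht₀ (IsLocalRing.residue C') IsLocalRing.residue_surjective IsLocalRing.ker_residue c' ι₀ hι g hg

/-! ## §3 S-e in any characteristic -/

/-- **S-e — KODAIRA–SPENCER SURJECTIVITY OF `𝒫′`, LIFT LEVEL, ANY CHARACTERISTIC** (the letter `stub_F3McN3Se` of the (Mc) N3′ tower with its binder
`[Algebra ℚ R]` removed): over a Noetherian affine base `Spec R` of any characteristic, for the abelian scheme `A′ = A ×_R S′` (`p : S′ → Spec R` finite
étale surjective), `π : A′ → Â` a homomorphism finite étale surjective with kernel `K(L′)` on points, `𝒫` rank one on `A′ × Â` rigidified along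
`ε × 1` with `(1 × π)^*𝒫 ≅ Λ(L′)`, and a principal small extension `q : C′ ↠ C` of Artinian local rings over `S′`: for every lift `g₁ : Spec C′ → Â`
and every `t ∈ H¹(A′_{C′}, 𝓘)` there is a lift `g₂` of the same `C`-point with `[(1 × g₂)^*𝒫] = [(1 × g₁)^*𝒫] + H¹(truncExp)(t)`.  Proof = ★
`exists_lift_detClassH_eq_add_smallExtension` verbatim, the target-space panel now §2 (any characteristic); the case `t₀ = 0` apart (★
`sheafH_idealSheafAb_eq_zero_of_isIso`); the principal case ★ `exists_lift_detClassH_eq_add_of_principal` (never used `ℚ`).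
[cite: MumfordAV1970, §13 (proof of the Theorem, pp. 125–130)] [cite: Hartshorne2010, §6 Thm. 6.4 (b) (pp. 50–51)] -/
theorem exists_lift_detClassH_eq_add_smallExtension_anyBase :
    ∀ (R : Type) [CommRing R] [IsNoetherianRing R] (A : AbelianSchemeOver (Spec (.of R)))
    (L : A.left.Modules) (hL : HasRank L 1)
    (_hε : CechPic.pullback A.unitSection (detClass (HasRank.isFiniteLocallyFree' hL)) = 1)
    (_hΘ : ∀ ⦃Ω : Type⦄ [Field Ω] [IsAlgClosed Ω] (s : Spec (.of Ω) ⟶ Spec (.of R)),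
      ∃ Θ : CartierDivisor (A.fibre s).toAbelianVariety.X.left, Θ.IsAmple ∧
        CechPic.pullback (X := (A.fibre s).toAbelianVariety.X.left) (pullback.fst A.X.hom s)
          (detClass (HasRank.isFiniteLocallyFree' hL)) = Θ.cechClass)
    {S' : Scheme.{0}} [IsAffine S'] (p : S' ⟶ Spec (.of R)) [IsFinite p] [Etale p] [Surjective p]
    (hH1 : ∀ (K₁ : Type) [Field K₁] (s : Spec (.of K₁) ⟶ S') {J : Type} [Finite J]
      (U : J → ((A.baseChange p).X ⊗ Over.mk s).left.Opens), (∀ i, IsAffineOpen (U i)) → iSup U = ⊤ →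
      Module.Finite K₁ (CechH1 (X := ((A.baseChange p).X ⊗ Over.mk s).left) (Limits.pullback.snd (A.baseChange p).X.hom s) U) ∧
        Module.finrank K₁ (CechH1 (X := ((A.baseChange p).X ⊗ Over.mk s).left) (Limits.pullback.snd (A.baseChange p).X.hom s) U) =
          ((A.baseChange p).fibre s).toAbelianVariety.dim)
    (hat : AbelianSchemeOver S') (π : (A.baseChange p).X ⟶ hat.X) [IsMonHom π]
    (_hπ : IsFinite π.left ∧ Etale π.left ∧ Surjective π.left)
    (P : ((A.baseChange p).prodLeft hat).Modules)
    (_hker : ∀ (T : Over S') (u : T ⟶ (A.baseChange p).X),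
      u ≫ π = 1 ↔ (A.baseChange p).MemKOfL ((Scheme.Modules.pullback (pullback.fst A.X.hom p)).obj L) u)
    (_h1 : HasRank P 1)
    (_hrig : Nonempty ((Scheme.Modules.pullback ((A.baseChange p).unitSlice hat)).obj P ≅ SheafOfModules.unit _))
    (_hsock : Nonempty ((Scheme.Modules.pullback ((A.baseChange p).X ◁ π).left).obj P ≅
      (A.baseChange p).mumfordBundle ((Scheme.Modules.pullback (pullback.fst A.X.hom p)).obj L)))
    (C' C : Type) [CommRing C'] [IsLocalRing C'] [IsArtinianRing C'] [CommRing C] [IsLocalRing C] [IsArtinianRing C]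
    (q : C' →+* C) (_hq : Function.Surjective q) (t₀ : C') (_hker₀ : RingHom.ker q = Ideal.span {t₀})
    (_htm : ∀ m ∈ IsLocalRing.maximalIdeal C', t₀ * m = 0) (_ht₀m : t₀ ∈ IsLocalRing.maximalIdeal C')
    (c' : Spec (.of C') ⟶ S')
    (ι₀ : Over.mk (Spec.map (CommRingCat.ofHom q) ≫ c') ⟶ Over.mk c') (_hι : ι₀.left = Spec.map (CommRingCat.ofHom q))
    [IsFirstOrderThickening ((A.baseChange p).X ◁ ι₀).left]
    (g₁ : Over.mk c' ⟶ hat.X) (t : (idealSheafAb ((A.baseChange p).X ◁ ι₀).left).H 1),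
    ∃ g₂ : Over.mk c' ⟶ hat.X, ι₀ ≫ g₂ = ι₀ ≫ g₁ ∧
      detClassH (HasRank.isFiniteLocallyFree' (hasRank_pullback _ _h1 :
          HasRank (X := ((A.baseChange p).X ⊗ Over.mk c').left)
            ((Scheme.Modules.pullback ((A.baseChange p).baseChangeToProd hat c' g₂.left (Over.w g₂))).obj P) 1)) =
        detClassH (HasRank.isFiniteLocallyFree' (hasRank_pullback _ _h1 :
          HasRank (X := ((A.baseChange p).X ⊗ Over.mk c').left)
            ((Scheme.Modules.pullback ((A.baseChange p).baseChangeToProd hat c' g₁.left (Over.w g₁))).obj P) 1)) +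
          Sheaf.H.map (truncExp ((A.baseChange p).X ◁ ι₀).left) 1 t := by
  intro R _ _ A L hL hε hΘ S' _ p _ _ _ hH1 hat π _ hπ P hker h1 hrig hsock C' C _ _ _ _ _ _ q hq t₀ hker₀ htm ht₀m c' ι₀ hι _ g₁ t
  -- the line bundle `L′ = L|_{A′}` on `A′ := A ×_R S′`, rigidified along `ε`
  have hL' : HasRank (X := (A.baseChange p).left) ((Scheme.Modules.pullback (pullback.fst A.X.hom p)).obj L) 1 :=
    hasRank_pullback _ hL
  have hε' : CechPic.pullback (A.baseChange p).unitSection (detClass (HasRank.isFiniteLocallyFree' hL')) = 1 :=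
    A.cechPic_pullback_unitSection_baseChange_eq_one p hL hε
  -- instances on `π` and `S′`
  haveI : IsLocallyNoetherian S' := LocallyOfFiniteType.isLocallyNoetherian p
  haveI : IsFinite π.left := hπ.1
  haveI : Etale π.left := hπ.2.1
  haveI : Surjective π.left := hπ.2.2
  haveI : IsAffineHom π.left := inferInstance
  -- CASE `t₀ = 0`: the thickening is trivial, `H¹(𝓘) = 0`, `g₂ := g₁`
  by_cases ht₀ : t₀ = 0
  · subst ht₀
    have hqinj : Function.Injective q := by
      rw [RingHom.injective_iff_ker_eq_bot, hker₀, Ideal.span_singleton_eq_bot]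
    haveI : IsIso (CommRingCat.ofHom q) :=
      (ConcreteCategory.isIso_iff_bijective (CommRingCat.ofHom q)).mpr ⟨hqinj, hq⟩
    haveI : IsIso ι₀.left := by rw [hι]; infer_instance
    haveI : IsIso ((Over.forget S').map ι₀) := ‹IsIso ι₀.left›
    haveI : IsIso ι₀ := isIso_of_reflects_iso ι₀ (Over.forget S')
    haveI : IsIso ((A.baseChange p).X ◁ ι₀) := inferInstance
    haveI : IsIso ((A.baseChange p).X ◁ ι₀).left := inferInstance
    refine ⟨g₁, rfl, ?_⟩
    rw [sheafH_idealSheafAb_eq_zero_of_isIso ((A.baseChange p).X ◁ ι₀).left 1 t, map_zero, add_zero]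
  -- the relative dimension `g` of the closed fibre `A′_κ` and the target-space panel (§2, any characteristic)
  -- (`have` first, then `obtain` — ED. 2 heartbeat cure, 125k → 30k for this declaration)
  have hrd := ((A.baseChange p).baseChange (Spec.map (CommRingCat.ofHom (residue C')) ≫ c')).exists_isOfRelDim
  obtain ⟨g, hg⟩ := hrd
  have hK4 := exists_addEquiv_idealCohomology_pi_residueField_smallExtension_anyBase R A p hH1 C' C q hq t₀ hker₀ htm ht₀ c' ι₀
    hι g hg
  obtain ⟨E, hE⟩ := hK4
  exact (A.baseChange p).exists_lift_detClassH_eq_add_of_principal hat π hL' hε' P h1 hker hrig hsock C' C q hq t₀ hker₀ htm ht₀m ht₀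
    c' ι₀ hι g hg E hE g₁ t

end AbelianSchemeOver

end Literature.AlgebraicGeometry.AbelianSchemes

end
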